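/-
Copyright (c) 2026 the pub-hodgecm-mathlib formalisation cell (harness21).  Prover seat hodgecm-mathlib-F0P3a-p01 (g18): road «S3-ram» (LEAD F0P3a-plan (g13);
owner F0P3a-p06), (Cnt2′) route B (chair F0P3a-p07 (g15) RULING (13)), organ (4c-ii) «A-EVEN TUBE EXCLUSION BY THE ISOTROPIC KERNEL»; 2026-09-02.
-/
import Literature.NumberTheory.Automorphic.UnitaryLatticeTreeHyperbolicPlaneSkewAdjoint   -- (this seat): §1–§2 algebra of `Φ₂`; brings ★ p849125 (4c) machinery (`forall_mulVec_mem_scaleLattice_axisVertex_of_forall`, `vecTwo_smul_vecThree_eq`)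
import Literature.NumberTheory.Automorphic.UnitaryLatticeTreeSelfDualTransitiveTwo         -- ★ (F0P3a-p07 (g11)): `exists_unitary_mapGL_stdLattice_eq_of_isSelfDualLattice_two_of_v_two`
import Literature.NumberTheory.Automorphic.UnitaryTwoCartanAnyInvolution                  -- ★ `UnitaryGroup.Two.antidiagonal_two_over_eq` (`Φ₂ = !![0,1;1,0]`)
import HarnessLib

/-!
# The lattice graph of a hermitian space — for the HYPERBOLIC block literal `ι(γ₂, u)` at the TOP root level the root region lies on the axis: the isotropic-kernel
# argument (Bruhat–Tits 1972 §10; Kottwitz 1986 §3; Labesse–Langlands 1979 §2)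

Topic `NumberTheory/Automorphic`; namespace `Literature.NumberTheory.Automorphic.UnitaryLatticeTree`.  THEOREMS ONLY (no definition, no instance, no notation, no named fact,
no `sorry`); kernel lane `--supports stmt-HodgeConjecture-24833`; datum-free (`K` with `Valued K ℤᵐ⁰`, `σ` any valuation-preserving involution, `|2| = 1`).  Cell
`pub/hodgecm-mathlib` (D-0151), crux H413; road «S3-ram» (count-neutral); (Cnt2′) route B, organ **(4c-ii)** = the REGIME-A-EVEN twin of ★ p849125 (4c): there the determinant
criterion `|det(γ₂ − u₀₀·1)| > |ϖ|^{2d₀+1}` FAILS (`v(det) = 2N = 2d₀ + 2`), and the root region `R` (A-p12 (g25) (4b): «the `q+1` centre vertices») is shown tube-free instead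
by the ISOTROPIC KERNEL of the residual `W`-block.

THE MATHEMATICS.  `W`-form `Φ₂ = !![0,1;1,0]` (the hyperbolic plane), block model `Φ₃ = ι-shape(Φ₂, 1)`, `Γ = ι(γ₂, u)` with `γ₂ ∈ U(σ, Φ₂)`, `c := ½tr γ₂`, `E := γ₂ − c·1`,
`T := γ₂ − u₀₀·1`.  Unitarity in the hyperbolic frame is the dictionary `σ(γ₀₀)·d = γ₀₀`, `σ(γ₁₁)·d = γ₁₁`, `σ(γ₀₁)·d = −γ₀₁`, `σ(γ₁₀)·d = −γ₁₀` (`d = det γ₂`, §1), whence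
`σ(c)·d = c` and the ADJOINT IDENTITY `⟨E a, v⟩ = −d⁻¹·⟨a, E v⟩` (§1 `pairing_sub_smul_mulVec_eq_neg_of_unitary_two`): `E` is `Φ₂`-skew up to the unit `d`, so it maps the
isotropic basis vectors `e_j` to ISOTROPIC vectors.  Now let `M` be self-dual for `Φ₃` with `(Γ − 1)·M ≤ ϖ^{d₀}·M` and tube coordinate `b ≥ 1`.  As in ★ p849125 §2 (axis vertex
`A(M) = κ·𝒪² ⊕ 𝒪e₁` with `κ ∈ U(σ, Φ₂)` by ★ rank-2 self-dual transitivity; `γ′ := κ⁻¹γ₂κ ∈ U(σ, Φ₂)` of level `ϖ^{d₀}` at `𝒪²`; unit-norm glue generator `y ∈ 𝒪²` with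
`T′y ∈ ϖ^{d₀+b}𝒪²`), the hypothesis `|c − u₀₀| ≤ |ϖ|^{d₀+1}` gives `E′y ∈ ϖ^{d₀+1}𝒪²`; TOP-ness (no `γ₂`-fixed self-dual `B` has `(γ₂ − c·1)B ≤ ϖ^{d₀+1}B`) gives a column
`x := ϖ^{−d₀}E′e_j` of `𝒪²` with a UNIT entry; and `⟨x, x⟩ = 0` (isotropy), `|⟨x, y⟩| ≤ |ϖ|` (adjoint identity + `E′y` small), `|⟨y, y⟩| = 1`.  §2 `false_of_isotropic_orthogonal_unit`
shows these four are incompatible over a nondegenerate residual plane (if `x̄ ∧ ȳ ≠ 0` then `x̄ ⊥ k²`, so `x̄ = 0`; else `ȳ ∈ k·x̄` is isotropic) — so `b = 0`: **THE ROOT REGION AT THE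
TOP LEVEL LIES ON THE AXIS** (§3 `single_one_one_mem_of_selfDual_lev_of_top`), with the `Φ₃`-model vertex form for ★ `strataCount_J₀_block_even`'s `hsR` (§3).
DICTIONARY (A-p12 (g25) 04:18:15Z): regime A ⟺ `d_c := v(½tr ĝ − û) ≥ N`; A-even: `N = 2n`, top self-dual depth `d₀ = N − 1` (★ (B-i) «top ball empty»), so `|c − u| ≤ |ϖ|^{d₀+1}` ✓ and
`htop` = ★ A-p12 `WSideBalls` top-ball emptiness in the centred token.  No discriminant hypothesis is needed: a `Φ₂`-skew residual matrix with a kernel vector is nilpotent.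
HONEST LABEL: HC_CM is proved only modulo the 2 remaining named inputs (hLiu418 24832, h413 24833) until rung 0 closes; nothing printed is asserted here (elementary lattice
bookkeeping); «S3-ram» has no books consequence.

## References
* [BruhatTits1972] F. Bruhat, J. Tits, *Groupes réductifs sur un corps local I*, Publ. Math. IHÉS 41 (1972), §10 (lattice models of the building; the axis of a Levi block).
* [Kottwitz1986] R. E. Kottwitz, *Base change for unit elements of Hecke algebras*, Compositio Math. 60 (1986), §3 (fixed lattices of a block element, counted along the axis).
* [LabesseLanglands1979] J.-P. Labesse, R. P. Langlands, *L-indistinguishability for SL(2)*, Canad. J. Math. 31 (1979), §2 Lemma 2.1 p. 8 (the centred element of an elliptic torus).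
* [Jacobowitz1962] R. Jacobowitz, *Hermitian forms over local fields*, Amer. J. Math. 84 (1962), §4 (sesquilinear pairings, adjoints).
* [Rogawski1990] J. D. Rogawski, *Automorphic Representations of Unitary Groups in Three Variables*, Ann. of Math. Stud. 123 (1990), §4.8 Case (a) p. 53, §4.9 pp. 54–56.
-/

set_option autoImplicit false

noncomputable section

open scoped Valued WithZero Matrix MatrixGroups

namespace Literature.NumberTheory.Automorphic.UnitaryLatticeTree

open Literature.NumberTheory.Automorphic Literature.NumberTheory.Automorphic.HermitianLattice Literature.NumberTheory.Rogawski1990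

variable {K : Type*} [Field K] [Valued K ℤᵐ⁰]

/-! ## §3 At the TOP root level a self-dual lattice of root level for the hyperbolic block literal lies on the axis -/

set_option maxHeartbeats 1600000 in -- budget only: statement-heavy block tokens and the ★ cone lemma's four-clause output.
/-- **THM 1 (A-even) — AT THE TOP ROOT LEVEL THE ROOT REGION OF THE HYPERBOLIC BLOCK LITERAL LIES ON THE AXIS.**  `Φ₃`-model, `Γ = ι(γ₂, u)` with `γ₂ ∈ U(σ, Φ₂)`
(`Φ₂ = !![0,1;1,0]`), `c := ½tr γ₂`.  Suppose `|c − u₀₀| ≤ |ϖ|^{d₀+1}` and TOP-ness: no `γ₂`-fixed self-dual `B ≤ K²` has `(γ₂ − c·1)·B ≤ ϖ^{d₀+1}·B` (★ A-p12 «top ball empty» in the centred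
token).  Then every self-dual `M` with `(Γ − 1)·M ≤ ϖ^{d₀}·M` contains `e₁` (tube coordinate `0`: an AXIS vertex).  No ellipticity ∕ discriminant hypothesis: the residual
`W`-block is `Φ₂`-skew with a kernel vector, hence nilpotent, and its image line is isotropic (§1–§2). [cite: Kottwitz1986, §3] [cite: BruhatTits1972, §10]
[cite: LabesseLanglands1979, §2 Lemma 2.1 p. 8] [cite: Rogawski1990, §4.9 pp. 54–56] -/
theorem single_one_one_mem_of_selfDual_lev_of_top [IsPrincipalIdealRing 𝒪[K]] (σ : K →+* K) (hσ : ∀ a, σ (σ a) = a)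
    (hvσ : ∀ a, Valued.v (σ a) = Valued.v a) {ϖ : K} (hϖ : Valued.v ϖ = WithZero.exp (-1 : ℤ)) (h2 : Valued.v (2 : K) = 1)
    (γ₂ : GL (Fin 2) K) (hγU : γ₂ ∈ unitaryGroupOfForm σ (!![(0 : K), 1; 1, 0] : Matrix (Fin 2) (Fin 2) K)) (u : GL (Fin 1) K) {d₀ : ℕ}
    (hα : Valued.v ((γ₂ : Matrix (Fin 2) (Fin 2) K).trace / 2 - (u : Matrix (Fin 1) (Fin 1) K) 0 0) ≤ Valued.v (ϖ ^ (d₀ + 1)))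
    (htop : {B : Submodule 𝒪[K] (Fin 2 → K) | IsSelfDualLattice σ ϖ (!![(0 : K), 1; 1, 0] : Matrix (Fin 2) (Fin 2) K) B ∧ mapGL γ₂ B = B ∧
        B.map ((Matrix.toLin' ((γ₂ : Matrix (Fin 2) (Fin 2) K) - ((γ₂ : Matrix (Fin 2) (Fin 2) K).trace / 2) • (1 : Matrix (Fin 2) (Fin 2) K))).restrictScalars 𝒪[K]) ≤
          scaleLattice (ϖ ^ (d₀ + 1)) B} = ∅)
    {M : Submodule 𝒪[K] (Fin 3 → K)} (hM : IsSelfDualLattice σ ϖ ((StdForm.antidiagonal 3).over K) M)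
    (hlev : ∀ x ∈ M, ((((endoGL (γ₂, u) : GL (Fin 3) K) : Matrix (Fin 3) (Fin 3) K) - 1) *ᵥ x) ∈ scaleLattice (ϖ ^ d₀) M) :
    (Pi.single 1 1 : Fin 3 → K) ∈ M := by
  have hϖ0' : Valued.v ϖ ≠ 0 := by rw [hϖ]; exact WithZero.exp_ne_zero
  have hϖ0 : ϖ ≠ 0 := fun h0 => by rw [h0, map_zero] at hϖ0'; exact hϖ0' rfl
  have hϖ1 : Valued.v ϖ < 1 := by rw [hϖ, ← WithZero.exp_zero]; exact WithZero.exp_lt_exp.2 (by norm_num)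
  have hϖ1' : Valued.v ϖ ≤ 1 := hϖ1.le
  have hc : (ϖ ^ d₀ : K) ≠ 0 := pow_ne_zero _ hϖ0
  have hc1 : (ϖ ^ (d₀ + 1) : K) ≠ 0 := pow_ne_zero _ hϖ0
  have h20 : (2 : K) ≠ 0 := fun h0 => by rw [h0, map_zero] at h2; exact zero_ne_one h2
  have hH₂ : IsUnit (!![(0 : K), 1; 1, 0] : Matrix (Fin 2) (Fin 2) K).det := by
    rw [Matrix.det_fin_two]; simp
  have hH₂σ : ((!![(0 : K), 1; 1, 0] : Matrix (Fin 2) (Fin 2) K).map σ)ᵀ = !![(0 : K), 1; 1, 0] := by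
    ext i j; fin_cases i <;> fin_cases j <;> simp
  have hSD' : IsSelfDualLattice σ ϖ
      (!![(!![(0 : K), 1; 1, 0] : Matrix (Fin 2) (Fin 2) K) 0 0, 0, (!![(0 : K), 1; 1, 0] : Matrix (Fin 2) (Fin 2) K) 0 1; 0, (1 : K), 0;
        (!![(0 : K), 1; 1, 0] : Matrix (Fin 2) (Fin 2) K) 1 0, 0, (!![(0 : K), 1; 1, 0] : Matrix (Fin 2) (Fin 2) K) 1 1] : Matrix (Fin 3) (Fin 3) K) M := by
    rw [← antidiagonal_three_over_eq_endoShape]; exact hM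
  obtain ⟨b, hb, -, x₀, hx₀, hx₀1⟩ := exists_tubeCoordinate σ hvσ hϖ hH₂ (h := 1) (by rw [map_one]) hSD'
  rcases Nat.eq_zero_or_pos b with rfl | hb1
  · exact (hb 1).2 (by rw [map_one, pow_zero])
  exfalso
  set T : Matrix (Fin 2) (Fin 2) K := (γ₂ : Matrix (Fin 2) (Fin 2) K) - (u : Matrix (Fin 1) (Fin 1) K) 0 0 • (1 : Matrix (Fin 2) (Fin 2) K) with hTdef
  obtain ⟨g₂, hSD₂, hA, -⟩ := exists_axisVertex_eq_latt_endoGL σ hσ hvσ hϖ hH₂ hH₂σ (h := 1) (by rw [map_one]) (map_one σ) hSD' hb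
  -- a UNITARY frame `κ` of the axis vertex (★ rank-2 self-dual transitivity)
  have hSD₂' : IsSelfDualLattice σ ϖ ((StdForm.antidiagonal 2).over K) (latt (g₂ : Matrix (Fin 2) (Fin 2) K)) := by
    rw [UnitaryGroup.Two.antidiagonal_two_over_eq]; exact hSD₂
  obtain ⟨κu, hκ⟩ := exists_unitary_mapGL_stdLattice_eq_of_isSelfDualLattice_two_of_v_two hσ hvσ hϖ h2 hSD₂'
  set κ : GL (Fin 2) K := (κu : GL (Fin 2) K) with hκdef
  have hκU : κ ∈ unitaryGroupOfForm σ (!![(0 : K), 1; 1, 0] : Matrix (Fin 2) (Fin 2) K) := by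
    have hm : (((κ : GL (Fin 2) K) : Matrix (Fin 2) (Fin 2) K).map σ)ᵀ * ((StdForm.antidiagonal 2).over K) * ((κ : GL (Fin 2) K) : Matrix (Fin 2) (Fin 2) K) =
        (StdForm.antidiagonal 2).over K := κu.2
    rw [UnitaryGroup.Two.antidiagonal_two_over_eq] at hm
    exact hm
  have hlatt : latt (g₂ : Matrix (Fin 2) (Fin 2) K) = latt (κ : Matrix (Fin 2) (Fin 2) K) := by rw [hκ]; rfl
  have hSDκ : IsSelfDualLattice σ ϖ (!![(0 : K), 1; 1, 0] : Matrix (Fin 2) (Fin 2) K) (latt (κ : Matrix (Fin 2) (Fin 2) K)) := by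
    rw [← hlatt]; exact hSD₂
  have hAκ : latt ((endoGL (κ, (1 : GL (Fin 1) K)) : GL (Fin 3) K) : Matrix (Fin 3) (Fin 3) K) =
      M ⊓ LinearMap.ker ((LinearMap.proj (1 : Fin 3) : (Fin 3 → K) →ₗ[K] K).restrictScalars 𝒪[K]) ⊔ scaleLattice (ϖ ^ b) M ⊔ Submodule.span 𝒪[K] {(Pi.single 1 1 : Fin 3 → K)} := by
    rw [← hA]; exact (latt_endoGL_one_eq_iff κ g₂).2 hlatt.symm
  -- ★ (c3-iv′) levels on the cone
  have hcol : ∀ l : Fin 3, l ≠ 1 → ((((endoGL (γ₂, u) : GL (Fin 3) K) : Matrix (Fin 3) (Fin 3) K) - 1)) l 1 = 0 := fun l hl => endoGL_sub_one_col γ₂ u l hl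
  have hrow : ∀ l : Fin 3, l ≠ 1 → ((((endoGL (γ₂, u) : GL (Fin 3) K) : Matrix (Fin 3) (Fin 3) K) - 1)) 1 l = 0 := fun l hl => endoGL_sub_one_row γ₂ u l hl
  obtain ⟨h11, -, hgen, -⟩ := (forall_mulVec_mem_scaleLattice_iff_of_cone σ hvσ hϖ hH₂ (h := 1) (by rw [map_one]) hSD' hb1 hb hx₀ hx₀1 hcol hrow hc).1 hlev
  rw [endoGL_sub_one_apply_one_one] at h11
  -- (§1 of ★ p849125) the level at the axis vertex, read in the unitary frame `κ`
  have hAlev := forall_mulVec_mem_scaleLattice_axisVertex_of_forall hϖ0 M b γ₂ u hc h11 hlev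
  rw [← hAκ] at hAlev
  have hAmap : (latt ((endoGL (κ, (1 : GL (Fin 1) K)) : GL (Fin 3) K) : Matrix (Fin 3) (Fin 3) K)).map
        ((Matrix.toLin' (((endoGL (γ₂, u) : GL (Fin 3) K) : Matrix (Fin 3) (Fin 3) K) - 1)).restrictScalars 𝒪[K]) ≤
      scaleLattice (ϖ ^ d₀) (latt ((endoGL (κ, (1 : GL (Fin 1) K)) : GL (Fin 3) K) : Matrix (Fin 3) (Fin 3) K)) :=
    Submodule.map_le_iff_le_comap.2 fun a ha => hAlev a ha
  obtain ⟨hWmap, -⟩ := (map_endoGL_sub_one_latt_endoGL_le_scaleLattice_iff hc κ γ₂ u).1 hAmap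
  have hent := (map_sub_one_latt_le_scaleLattice_iff hc γ₂ κ).1 hWmap
  have hg : IsUnit (κ : Matrix (Fin 2) (Fin 2) K).det := Matrix.isUnits_det_units _
  have hginv : ((κ⁻¹ : GL (Fin 2) K) : Matrix (Fin 2) (Fin 2) K) = (κ : Matrix (Fin 2) (Fin 2) K)⁻¹ := Matrix.coe_units_inv κ
  -- `latt κ` is `γ₂`-fixed, hence (TOP-ness) NOT of centred level `ϖ^{d₀+1}`
  have hfix : mapGL γ₂ (latt (κ : Matrix (Fin 2) (Fin 2) K)) = latt (κ : Matrix (Fin 2) (Fin 2) K) := by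
    have hle : mapGL γ₂ (latt (κ : Matrix (Fin 2) (Fin 2) K)) ≤ latt (κ : Matrix (Fin 2) (Fin 2) K) := by
      refine Submodule.map_le_iff_le_comap.2 fun w hw => ?_
      have h1 : ((γ₂ : Matrix (Fin 2) (Fin 2) K) - 1) *ᵥ w ∈ latt (κ : Matrix (Fin 2) (Fin 2) K) :=
        scaleLattice_le_self_of_v_le_one (by rw [map_pow]; exact pow_le_one₀ zero_le hϖ1') _
          (hWmap (Submodule.mem_map_of_mem (f := (Matrix.toLin' ((γ₂ : Matrix (Fin 2) (Fin 2) K) - 1)).restrictScalars 𝒪[K]) hw))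
      have e : (γ₂ : Matrix (Fin 2) (Fin 2) K) *ᵥ w = ((γ₂ : Matrix (Fin 2) (Fin 2) K) - 1) *ᵥ w + w := by
        rw [Matrix.sub_mulVec, Matrix.one_mulVec, sub_add_cancel]
      show (Matrix.toLin' (γ₂ : Matrix (Fin 2) (Fin 2) K)) w ∈ latt (κ : Matrix (Fin 2) (Fin 2) K)
      rw [Matrix.toLin'_apply, e]
      exact Submodule.add_mem _ h1 hw
    exact eq_of_le_of_isVertexLattice hvσ hϖ0 (isVertexLattice_mapGL σ ϖ _ γ₂ hγU hSDκ) hSDκ hle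
  set c : K := (γ₂ : Matrix (Fin 2) (Fin 2) K).trace / 2 with hcdef
  have hnotop : ¬ (latt (κ : Matrix (Fin 2) (Fin 2) K)).map ((Matrix.toLin' ((γ₂ : Matrix (Fin 2) (Fin 2) K) - c • (1 : Matrix (Fin 2) (Fin 2) K))).restrictScalars 𝒪[K]) ≤
      scaleLattice (ϖ ^ (d₀ + 1)) (latt (κ : Matrix (Fin 2) (Fin 2) K)) := by
    intro hle
    have hmem : latt (κ : Matrix (Fin 2) (Fin 2) K) ∈ {B : Submodule 𝒪[K] (Fin 2 → K) | IsSelfDualLattice σ ϖ (!![(0 : K), 1; 1, 0] : Matrix (Fin 2) (Fin 2) K) B ∧ mapGL γ₂ B = B ∧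
        B.map ((Matrix.toLin' ((γ₂ : Matrix (Fin 2) (Fin 2) K) - ((γ₂ : Matrix (Fin 2) (Fin 2) K).trace / 2) • (1 : Matrix (Fin 2) (Fin 2) K))).restrictScalars 𝒪[K]) ≤
          scaleLattice (ϖ ^ (d₀ + 1)) B} := ⟨hSDκ, hfix, hle⟩
    rw [htop] at hmem
    exact hmem
  rw [map_toLin'_latt_le_scaleLattice_iff hc1 _ hg] at hnotop
  simp only [not_forall, not_le] at hnotop
  obtain ⟨i₁, j₁, hij⟩ := hnotop
  -- the frame-`κ` block `γ′ = κ⁻¹γ₂κ ∈ U(σ, Φ₂)`, its centred and `u`-centred versions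
  set γ' : GL (Fin 2) K := κ⁻¹ * γ₂ * κ with hγ'def
  have hγ'U : γ' ∈ unitaryGroupOfForm σ (!![(0 : K), 1; 1, 0] : Matrix (Fin 2) (Fin 2) K) :=
    Subgroup.mul_mem _ (Subgroup.mul_mem _ (Subgroup.inv_mem _ hκU) hγU) hκU
  have htr : (γ' : Matrix (Fin 2) (Fin 2) K).trace = (γ₂ : Matrix (Fin 2) (Fin 2) K).trace := by
    rw [hγ'def, Units.val_mul, Units.val_mul, Matrix.mul_assoc, Matrix.trace_mul_comm, Matrix.mul_assoc, ← Units.val_mul, mul_inv_cancel, Units.val_one,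
      Matrix.mul_one]
  set E' : Matrix (Fin 2) (Fin 2) K := (γ' : Matrix (Fin 2) (Fin 2) K) - c • (1 : Matrix (Fin 2) (Fin 2) K) with hE'def
  have hE'eq : (κ : Matrix (Fin 2) (Fin 2) K)⁻¹ * ((γ₂ : Matrix (Fin 2) (Fin 2) K) - c • (1 : Matrix (Fin 2) (Fin 2) K)) * (κ : Matrix (Fin 2) (Fin 2) K) = E' := by
    rw [hE'def, hγ'def, Units.val_mul, Units.val_mul, hginv, Matrix.mul_sub, Matrix.sub_mul, Matrix.mul_smul, Matrix.mul_one, Matrix.smul_mul,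
      Matrix.nonsing_inv_mul _ hg]
  rw [hE'eq] at hij
  -- entries of `E′` lie in `ϖ^{d₀}𝒪`
  have hcu : Valued.v (c - 1) ≤ Valued.v (ϖ ^ d₀) := by
    have e : c - 1 = (c - (u : Matrix (Fin 1) (Fin 1) K) 0 0) + ((u : Matrix (Fin 1) (Fin 1) K) 0 0 - 1) := by ring
    rw [e]
    refine (Valuation.map_add _ _ _).trans (max_le (hα.trans ?_) h11)
    rw [map_pow, map_pow]; exact pow_le_pow_right_of_le_one' hϖ1' (Nat.le_succ d₀)
  have hE'ent : ∀ i k, Valued.v (E' i k) ≤ Valued.v (ϖ ^ d₀) := by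
    intro i k
    have e : E' i k = ((((κ⁻¹ * γ₂ * κ : GL (Fin 2) K) : Matrix (Fin 2) (Fin 2) K) - 1) i k) - (c - 1) * (1 : Matrix (Fin 2) (Fin 2) K) i k := by
      rw [hE'def, hγ'def, Matrix.sub_apply, Matrix.sub_apply, Matrix.smul_apply, smul_eq_mul]; ring
    rw [e]
    refine (Valuation.map_sub _ _ _).trans (max_le (hent i k) ?_)
    by_cases hik : i = k
    · rw [hik, Matrix.one_apply_eq, mul_one]; exact hcu
    · rw [Matrix.one_apply_ne hik, mul_zero, map_zero]; exact zero_le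
  -- the unit-norm glue generator `y` in the frame `κ`
  obtain ⟨hzA, hzz, -, -⟩ := cone_anatomy_of_tubeCoordinate σ hvσ hϖ hH₂ (h := 1) (by rw [map_one]) hSD' hb1 hb hx₀ hx₀1
  set z : Fin 3 → K := (ϖ ^ b) • (x₀ - Pi.single 1 (x₀ 1)) with hzdef
  have hz1 : z 1 = 0 := by simp [hzdef]
  rw [← hAκ, mem_latt_endoGL_one_iff] at hzA
  obtain ⟨hzW, -⟩ := hzA
  rw [pairing_endoShape_apply, hz1, map_zero, zero_mul, zero_mul, add_zero] at hzz
  set zW : Fin 2 → K := ![z 0, z 2] with hzWdef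
  set y : Fin 2 → K := (κ : Matrix (Fin 2) (Fin 2) K)⁻¹ *ᵥ zW with hydef
  have hy : ∀ i, Valued.v (y i) ≤ 1 := mem_stdLattice.1 ((mem_latt_iff_of_isUnit hg zW).1 hzW)
  have hzWy : zW = (κ : Matrix (Fin 2) (Fin 2) K) *ᵥ y := by
    rw [hydef, Matrix.mulVec_mulVec, Matrix.mul_nonsing_inv _ hg, Matrix.one_mulVec]
  have hyy : Valued.v (pairing σ (!![(0 : K), 1; 1, 0] : Matrix (Fin 2) (Fin 2) K) y y) = 1 := by
    rw [← pairing_mulVec_mulVec_of_mem_unitary (σ := σ) hκU y y, ← hzWy]; exact hzz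
  -- `T′ y` is small (★ (c3-iv′) generator clause), hence so is `E′ y`
  rw [endoGL_sub_one_sub_smul_one, endoGL_sub_smul_one_mulVec_eq, ← hAκ, mem_scaleLattice_iff (mul_ne_zero (pow_ne_zero b hϖ0) hc), mem_latt_endoGL_one_iff,
    vecTwo_smul_vecThree_eq, mem_latt_iff_of_isUnit hg, Matrix.mulVec_smul, mem_stdLattice] at hgen
  obtain ⟨hgenW, -⟩ := hgen
  have hpos : 0 < Valued.v (ϖ ^ b * ϖ ^ d₀) := zero_lt_iff.2 ((Valuation.ne_zero_iff _).2 (mul_ne_zero (pow_ne_zero b hϖ0) hc))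
  have hE'y : ∀ i, Valued.v ((E' *ᵥ y) i) ≤ Valued.v (ϖ ^ (d₀ + 1)) := by
    have hTy : E' *ᵥ y = (κ : Matrix (Fin 2) (Fin 2) K)⁻¹ *ᵥ (T *ᵥ zW) + ((u : Matrix (Fin 1) (Fin 1) K) 0 0 - c) • y := by
      have e : E' = (κ : Matrix (Fin 2) (Fin 2) K)⁻¹ * T * (κ : Matrix (Fin 2) (Fin 2) K) + ((u : Matrix (Fin 1) (Fin 1) K) 0 0 - c) • (1 : Matrix (Fin 2) (Fin 2) K) := by
        rw [hE'def, hγ'def, hTdef, Units.val_mul, Units.val_mul, hginv, Matrix.mul_sub, Matrix.sub_mul, Matrix.mul_smul, Matrix.mul_one, Matrix.smul_mul,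
          Matrix.nonsing_inv_mul _ hg, sub_smul]
        abel
      rw [e, Matrix.add_mulVec, Matrix.smul_mulVec, Matrix.one_mulVec, hzWy, ← Matrix.mulVec_mulVec, ← Matrix.mulVec_mulVec]
    intro i
    rw [hTy, Pi.add_apply, Pi.smul_apply, smul_eq_mul]
    refine (Valuation.map_add _ _ _).trans (max_le ?_ ?_)
    · have hi := hgenW i
      rw [Pi.smul_apply, smul_eq_mul, map_mul, map_inv₀, inv_mul_le_iff₀ hpos, mul_one] at hi
      refine hi.trans ?_
      rw [← pow_add, map_pow, map_pow]
      exact pow_le_pow_right_of_le_one' hϖ1' (by omega)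
    · rw [map_mul, Valuation.map_sub_swap]
      exact (mul_le_mul' hα (hy i)).trans (le_of_eq (mul_one _))
  -- the column `x := ϖ^{-d₀}·E′e_{j₁}`: integral, with a unit entry
  set x : Fin 2 → K := (ϖ ^ d₀)⁻¹ • (E' *ᵥ (Pi.single j₁ 1 : Fin 2 → K)) with hxdef
  have hEcol : ∀ i, (E' *ᵥ (Pi.single j₁ 1 : Fin 2 → K)) i = E' i j₁ := fun i => by
    rw [Matrix.mulVec_single_one]; rfl
  have hvc0 : 0 < Valued.v (ϖ ^ d₀) := zero_lt_iff.2 ((Valuation.ne_zero_iff _).2 hc)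
  have hx : ∀ i, Valued.v (x i) ≤ 1 := fun i => by
    rw [hxdef, Pi.smul_apply, smul_eq_mul, hEcol, map_mul, map_inv₀, inv_mul_le_iff₀ hvc0, mul_one]
    exact hE'ent i j₁
  have hxi : Valued.v (x i₁) = 1 := by
    refine le_antisymm (hx i₁) (not_lt.1 fun hlt => ?_)
    have hle : Valued.v (x i₁) ≤ Valued.v ϖ := by rw [hϖ]; exact (v_lt_one_iff _).1 hlt
    rw [hxdef, Pi.smul_apply, smul_eq_mul, hEcol, map_mul, map_inv₀, inv_mul_le_iff₀ hvc0, ← map_mul, ← pow_succ] at hle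
    exact absurd hle (not_le.2 hij)
  -- `x` is isotropic and residually orthogonal to `y`
  have he : ∀ i, Valued.v ((Pi.single j₁ 1 : Fin 2 → K) i) ≤ 1 := fun i => by
    by_cases hij1 : i = j₁
    · rw [hij1, Pi.single_eq_same, map_one]
    · rw [Pi.single_eq_of_ne hij1, map_zero]; exact zero_le
  have hadj := pairing_sub_smul_mulVec_eq_neg_of_unitary_two σ h20 hγ'U
  rw [htr, ← hcdef] at hadj
  have hE'sq : ((γ' : Matrix (Fin 2) (Fin 2) K) - c • (1 : Matrix (Fin 2) (Fin 2) K)) * ((γ' : Matrix (Fin 2) (Fin 2) K) - c • (1 : Matrix (Fin 2) (Fin 2) K)) =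
      (c ^ 2 - (γ' : Matrix (Fin 2) (Fin 2) K).det) • (1 : Matrix (Fin 2) (Fin 2) K) := by
    have h := sub_half_trace_smul_one_mul_self h20 (γ' : Matrix (Fin 2) (Fin 2) K)
    rw [htr, ← hcdef] at h
    exact h
  have hxx : Valued.v (pairing σ (!![(0 : K), 1; 1, 0] : Matrix (Fin 2) (Fin 2) K) x x) ≤ Valued.v ϖ := by
    have h0 : pairing σ (!![(0 : K), 1; 1, 0] : Matrix (Fin 2) (Fin 2) K) (E' *ᵥ (Pi.single j₁ 1 : Fin 2 → K)) (E' *ᵥ (Pi.single j₁ 1 : Fin 2 → K)) = 0 := by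
      rw [hE'def, hadj, Matrix.mulVec_mulVec, hE'sq, Matrix.smul_mulVec, Matrix.one_mulVec, map_smul, smul_eq_mul, pairing_antidiag_two_single_self,
        mul_zero, mul_zero]
    rw [hxdef, pairing_smul_smul, h0, mul_zero, mul_zero, map_zero]; exact zero_le
  have hd1 : Valued.v ((γ' : Matrix (Fin 2) (Fin 2) K).det) = 1 := v_det_eq_one_of_mem_unitary σ hvσ hγ'U hH₂
  have hxy : Valued.v (pairing σ (!![(0 : K), 1; 1, 0] : Matrix (Fin 2) (Fin 2) K) x y) ≤ Valued.v ϖ := by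
    rw [hxdef, LinearMap.map_smulₛₗ (pairing σ (!![(0 : K), 1; 1, 0] : Matrix (Fin 2) (Fin 2) K)) ((ϖ ^ d₀)⁻¹) _, LinearMap.smul_apply, smul_eq_mul, hE'def, hadj,
      map_mul, hvσ, map_inv₀, map_mul, Valuation.map_neg, map_inv₀, hd1, inv_one, one_mul]
    rw [inv_mul_le_iff₀ hvc0]
    refine (v_pairing_antidiag_two_le hvσ he hE'y).trans ?_
    rw [one_mul, ← map_mul, ← pow_succ]
  exact false_of_isotropic_orthogonal_unit hvσ hϖ hx hxi hy hxx hxy hyy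

set_option maxHeartbeats 1600000 in -- budget only: statement-heavy lattice tokens.
/-- **THM 2 (A-even) — VERTEX FORM for ★ `strataCount_J₀_block_even`'s `hsR`**: for `γ ∈ U(σ, Φ₃)` with matrix `ι(γ₂, u)`, `γ₂ ∈ U(σ, Φ₂)`, `|½tr γ₂ − u₀₀| ≤ |ϖ|^{d₀+1}` and
TOP-ness at `d₀`, every vertex of the root region `{v ∣ γ·v = v ∧ SD v.1 ∧ (γ − 1)·v.1 ≤ ϖ^{d₀}·v.1}` is an AXIS vertex (`e₁ ∈ v.1`). [cite: Kottwitz1986, §3] [cite: BruhatTits1972, §10]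
[cite: Rogawski1990, §4.9 pp. 54–56] -/
theorem single_one_one_mem_of_mem_rootRegion_of_top [IsPrincipalIdealRing 𝒪[K]] {σ : K →+* K} {ϖ : K}
    (hσ : ∀ a, σ (σ a) = a) (hvσ : ∀ a, Valued.v (σ a) = Valued.v a) (hϖ : Valued.v ϖ = WithZero.exp (-1 : ℤ)) (h2 : Valued.v (2 : K) = 1)
    (γ : unitaryGroupOfForm σ ((StdForm.antidiagonal 3).over K)) (γ₂ : GL (Fin 2) K) (u : GL (Fin 1) K) (hγ : (γ : GL (Fin 3) K) = endoGL (γ₂, u))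
    (hγU : γ₂ ∈ unitaryGroupOfForm σ (!![(0 : K), 1; 1, 0] : Matrix (Fin 2) (Fin 2) K)) {d₀ : ℕ}
    (hα : Valued.v ((γ₂ : Matrix (Fin 2) (Fin 2) K).trace / 2 - (u : Matrix (Fin 1) (Fin 1) K) 0 0) ≤ Valued.v (ϖ ^ (d₀ + 1)))
    (htop : {B : Submodule 𝒪[K] (Fin 2 → K) | IsSelfDualLattice σ ϖ (!![(0 : K), 1; 1, 0] : Matrix (Fin 2) (Fin 2) K) B ∧ mapGL γ₂ B = B ∧
        B.map ((Matrix.toLin' ((γ₂ : Matrix (Fin 2) (Fin 2) K) - ((γ₂ : Matrix (Fin 2) (Fin 2) K).trace / 2) • (1 : Matrix (Fin 2) (Fin 2) K))).restrictScalars 𝒪[K]) ≤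
          scaleLattice (ϖ ^ (d₀ + 1)) B} = ∅) :
    ∀ v : {M : Submodule 𝒪[K] (Fin 3 → K) // IsVertex σ ϖ ((StdForm.antidiagonal 3).over K) M},
      v ∈ {v : {M : Submodule 𝒪[K] (Fin 3 → K) // IsVertex σ ϖ ((StdForm.antidiagonal 3).over K) M} |
        latticeGraphIso σ ϖ ((StdForm.antidiagonal 3).over K) γ v = v ∧ IsSelfDualLattice σ ϖ ((StdForm.antidiagonal 3).over K) v.1 ∧
          v.1.map ((Matrix.toLin' (((γ : GL (Fin 3) K) : Matrix (Fin 3) (Fin 3) K) - 1)).restrictScalars 𝒪[K]) ≤ scaleLattice (ϖ ^ d₀) v.1} →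
      (Pi.single 1 1 : Fin 3 → K) ∈ v.1 := by
  rintro v ⟨-, hSD, hlev⟩
  rw [hγ] at hlev
  exact single_one_one_mem_of_selfDual_lev_of_top σ hσ hvσ hϖ h2 γ₂ hγU u hα htop hSD (forall_mulVec_mem_scaleLattice_of_map_le _ _ _ hlev)

set_option maxHeartbeats 1600000 in -- budget only: statement-heavy lattice tokens.
/-- **THM 3 (A-even) — COUNT FORM**: under THM 2's hypotheses and `|u₀₀| = 1`, `|u₀₀ − 1| ≤ |ϖ|^{d₀}`, the root region of the head's `hsR` is counted on the `W`-side: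
`#{v ∣ γ·v = v ∧ SD v.1 ∧ (γ − 1)·v.1 ≤ ϖ^{d₀}·v.1} = #{B ∣ SD_{Φ₂} B ∧ γ₂·B = B ∧ (γ₂ − 1)·B ≤ ϖ^{d₀}·B}` (A-p12's ★ top W-shell: the `q+1` centre vertices).
[cite: Kottwitz1986, §3] [cite: BruhatTits1972, §10] [cite: Rogawski1990, §4.9 pp. 54–56] -/
theorem ncard_rootRegion_eq_ncard_two_of_top [IsPrincipalIdealRing 𝒪[K]] {σ : K →+* K} {ϖ : K}
    (hσ : ∀ a, σ (σ a) = a) (hvσ : ∀ a, Valued.v (σ a) = Valued.v a) (hϖ : Valued.v ϖ = WithZero.exp (-1 : ℤ)) (h2 : Valued.v (2 : K) = 1)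
    (γ : unitaryGroupOfForm σ ((StdForm.antidiagonal 3).over K)) (γ₂ : GL (Fin 2) K) (u : GL (Fin 1) K) (hγ : (γ : GL (Fin 3) K) = endoGL (γ₂, u))
    (hγU : γ₂ ∈ unitaryGroupOfForm σ (!![(0 : K), 1; 1, 0] : Matrix (Fin 2) (Fin 2) K))
    (hu : Valued.v ((u : Matrix (Fin 1) (Fin 1) K) 0 0) = 1) {d₀ : ℕ} (hud : Valued.v ((u : Matrix (Fin 1) (Fin 1) K) 0 0 - 1) ≤ Valued.v (ϖ ^ d₀))
    (hα : Valued.v ((γ₂ : Matrix (Fin 2) (Fin 2) K).trace / 2 - (u : Matrix (Fin 1) (Fin 1) K) 0 0) ≤ Valued.v (ϖ ^ (d₀ + 1)))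
    (htop : {B : Submodule 𝒪[K] (Fin 2 → K) | IsSelfDualLattice σ ϖ (!![(0 : K), 1; 1, 0] : Matrix (Fin 2) (Fin 2) K) B ∧ mapGL γ₂ B = B ∧
        B.map ((Matrix.toLin' ((γ₂ : Matrix (Fin 2) (Fin 2) K) - ((γ₂ : Matrix (Fin 2) (Fin 2) K).trace / 2) • (1 : Matrix (Fin 2) (Fin 2) K))).restrictScalars 𝒪[K]) ≤
          scaleLattice (ϖ ^ (d₀ + 1)) B} = ∅) :
    {v : {M : Submodule 𝒪[K] (Fin 3 → K) // IsVertex σ ϖ ((StdForm.antidiagonal 3).over K) M} |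
        latticeGraphIso σ ϖ ((StdForm.antidiagonal 3).over K) γ v = v ∧ IsSelfDualLattice σ ϖ ((StdForm.antidiagonal 3).over K) v.1 ∧
          v.1.map ((Matrix.toLin' (((γ : GL (Fin 3) K) : Matrix (Fin 3) (Fin 3) K) - 1)).restrictScalars 𝒪[K]) ≤ scaleLattice (ϖ ^ d₀) v.1}.ncard =
    {B : Submodule 𝒪[K] (Fin 2 → K) | IsSelfDualLattice σ ϖ (!![(0 : K), 1; 1, 0] : Matrix (Fin 2) (Fin 2) K) B ∧ mapGL γ₂ B = B ∧
        B.map ((Matrix.toLin' ((γ₂ : Matrix (Fin 2) (Fin 2) K) - 1)).restrictScalars 𝒪[K]) ≤ scaleLattice (ϖ ^ d₀) B}.ncard := by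
  have hϖ0' : Valued.v ϖ ≠ 0 := by rw [hϖ]; exact WithZero.exp_ne_zero
  have hϖ0 : ϖ ≠ 0 := fun h0 => by rw [h0, map_zero] at hϖ0'; exact hϖ0' rfl
  have hϖ1 : Valued.v ϖ ≤ 1 := by rw [hϖ, ← WithZero.exp_zero]; exact WithZero.exp_le_exp.2 (by norm_num)
  have hH₂ : IsUnit (!![(0 : K), 1; 1, 0] : Matrix (Fin 2) (Fin 2) K).det := by
    rw [Matrix.det_fin_two]; simp
  -- the vertex set is the copy of the lattice set under `v ↦ v.1`, and every member is an axis vertex (THM 1)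
  have himg : (Subtype.val '' {v : {M : Submodule 𝒪[K] (Fin 3 → K) // IsVertex σ ϖ ((StdForm.antidiagonal 3).over K) M} |
        latticeGraphIso σ ϖ ((StdForm.antidiagonal 3).over K) γ v = v ∧ IsSelfDualLattice σ ϖ ((StdForm.antidiagonal 3).over K) v.1 ∧
          v.1.map ((Matrix.toLin' (((γ : GL (Fin 3) K) : Matrix (Fin 3) (Fin 3) K) - 1)).restrictScalars 𝒪[K]) ≤ scaleLattice (ϖ ^ d₀) v.1}) =
      {M : Submodule 𝒪[K] (Fin 3 → K) | IsSelfDualLattice σ ϖ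
          (!![(!![(0 : K), 1; 1, 0] : Matrix (Fin 2) (Fin 2) K) 0 0, 0, (!![(0 : K), 1; 1, 0] : Matrix (Fin 2) (Fin 2) K) 0 1; 0, (1 : K), 0;
            (!![(0 : K), 1; 1, 0] : Matrix (Fin 2) (Fin 2) K) 1 0, 0, (!![(0 : K), 1; 1, 0] : Matrix (Fin 2) (Fin 2) K) 1 1] : Matrix (Fin 3) (Fin 3) K) M ∧
        mapGL (endoGL (γ₂, u)) M = M ∧ (Pi.single 1 1 : Fin 3 → K) ∈ M ∧
        M.map ((Matrix.toLin' (((endoGL (γ₂, u) : GL (Fin 3) K) : Matrix (Fin 3) (Fin 3) K) - 1)).restrictScalars 𝒪[K]) ≤ scaleLattice (ϖ ^ d₀) M} := by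
    ext M
    simp only [Set.mem_image, Set.mem_setOf_eq]
    constructor
    · rintro ⟨v, ⟨hfix, hSD, hlev⟩, rfl⟩
      have e := congrArg Subtype.val hfix
      rw [latticeGraphIso_apply_coe, hγ] at e
      have hSD' : IsSelfDualLattice σ ϖ
          (!![(!![(0 : K), 1; 1, 0] : Matrix (Fin 2) (Fin 2) K) 0 0, 0, (!![(0 : K), 1; 1, 0] : Matrix (Fin 2) (Fin 2) K) 0 1; 0, (1 : K), 0;
            (!![(0 : K), 1; 1, 0] : Matrix (Fin 2) (Fin 2) K) 1 0, 0, (!![(0 : K), 1; 1, 0] : Matrix (Fin 2) (Fin 2) K) 1 1] : Matrix (Fin 3) (Fin 3) K) v.1 := by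
        rw [← antidiagonal_three_over_eq_endoShape]; exact hSD
      rw [hγ] at hlev
      exact ⟨hSD', e, single_one_one_mem_of_selfDual_lev_of_top σ hσ hvσ hϖ h2 γ₂ hγU u hα htop hSD
        (forall_mulVec_mem_scaleLattice_of_map_le _ _ _ hlev), hlev⟩
    · rintro ⟨hSD, hfix, -, hlev⟩
      rw [← antidiagonal_three_over_eq_endoShape] at hSD
      refine ⟨⟨M, 0, hSD⟩, ⟨?_, hSD, ?_⟩, rfl⟩
      · apply Subtype.ext
        rw [latticeGraphIso_apply_coe, hγ]
        exact hfix
      · rw [hγ]; exact hlev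
  rw [← Set.ncard_image_of_injective _ Subtype.val_injective, himg]
  exact ncard_selfDual_fixed_axis_lev_eq σ hvσ hϖ0 hϖ1 hH₂ (h := 1) (by rw [map_one]) γ₂ hu (pow_ne_zero d₀ hϖ0) hud

end Literature.NumberTheory.Automorphic.UnitaryLatticeTree

end
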